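import Mathlib
import Literature.MathematicalPhysics.QuantumLattice.Imbrie2016.LLA
import HarnessLib

/-!
# Imbrie (2016), eq. (5.3): positive homogeneity of the ordered eigenvalues (the input
# `∂D_{αβ}/∂r = D_{αβ}(r₀)/r₀`)

CITATION HEADER (lean-in-tree rule 2026-08-18). J. Z. Imbrie, *On many-body localization for quantum spin chains*,
J. Stat. Phys. **163** (2016) 998–1048, doi 10.1007/s10955-016-1508-x, arXiv:1403.7837 [ImbrieJSP2016], Ch. 5, eq. (5.3)
and the sentence following it ("we are just scaling H̄̄ here"). WHAT IS REPRODUCED: the elementary spectral fact behind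
(5.3) — for a Hermitian matrix `A` and a real `c ≥ 0`, the ORDERED eigenvalue enumeration of `c • A` (Mathlib's
`Matrix.IsHermitian.eigenvalues`, sorted non-increasingly) is `c •` that of `A` (`eigenvalues_smul_real`), hence every
eigenvalue difference `D_{αβ}` is positively homogeneous of degree one along rays in coupling space once the Hamiltonian is
linear in the couplings (`eigs_eq_smul_of_H_eq_smul`, `SmallGap_iff_of_H_eq_smul`; the linearity `H(γ; c • t) = c • H(γ; t)`
of the chain Hamiltonian (1.1)/(LLA.H) is kernel-checked separately as `SmallGapDictionary.H_smul`). Euler's identity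
`∂_r D = D(r₀)/r₀` for the degree-one homogeneous function `r ↦ D(r u)` is then immediate and is not restated.
NOT reproduced: (5.4) (the comparison of derivatives of `E^{(j')}_α` with those of H̄̄'s eigenvalues), Theorem 5.1, LLA.

Used by the audit cell `pub-imbrie` (LLA.md block WB, item WB3) — evidence bookkeeping only; nothing here asserts LLA or
Theorem 1.1.
-/

noncomputable section

namespace Literature.MathematicalPhysics.QuantumLattice.Imbrie2016.EigenvalueScaling

open Matrix Polynomial Unitary

variable {𝕜 : Type*} [RCLike 𝕜] {n : Type*} [Fintype n] [DecidableEq n] {A : Matrix n n 𝕜}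

omit [Fintype n] [DecidableEq n] in
/-- [cite: ImbrieJSP2016, eq. (5.3)] A real multiple of a Hermitian matrix is Hermitian. -/
theorem isHermitian_smul_real (hA : A.IsHermitian) (c : ℝ) : (c • A).IsHermitian :=
  hA.smul (IsSelfAdjoint.all c)

omit [Fintype n] [DecidableEq n] in
/-- [cite: ImbrieJSP2016, eq. (5.3)] Real scalar action written through the coercion `ℝ → 𝕜`. -/
theorem smul_real_eq_coe_smul (A : Matrix n n 𝕜) (c : ℝ) : c • A = (c : 𝕜) • A := by
  ext i j
  simp [Matrix.smul_apply, RCLike.real_smul_eq_coe_mul]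

/-- [cite: ImbrieJSP2016, eq. (5.3)] Characteristic polynomial of `c • A` for Hermitian `A`:
`∏ (X - c·λ_i)`, via the spectral theorem `A = U diag(λ) U⋆`. -/
theorem charpoly_smul_real (hA : A.IsHermitian) (c : ℝ) :
    (c • A).charpoly = ∏ i, (X - C (((c * hA.eigenvalues i : ℝ)) : 𝕜)) := by
  have hD : (c : 𝕜) • diagonal (RCLike.ofReal ∘ hA.eigenvalues) =
      diagonal (fun i => (((c * hA.eigenvalues i : ℝ)) : 𝕜)) := by
    rw [← diagonal_smul]
    congr 1
    funext i
    simp only [Pi.smul_apply, Function.comp_apply, smul_eq_mul, RCLike.ofReal_mul]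
  have hcA : c • A = conjStarAlgAut 𝕜 _ hA.eigenvectorUnitary
      (diagonal fun i => (((c * hA.eigenvalues i : ℝ)) : 𝕜)) := by
    rw [← hD, map_smul, ← hA.spectral_theorem, smul_real_eq_coe_smul]
  rw [hcA, conjStarAlgAut_apply, charpoly_mul_comm, ← mul_assoc]
  simp [charpoly_diagonal]

/-- [cite: ImbrieJSP2016, eq. (5.3)] The roots of the characteristic polynomial of `c • A`. -/
theorem roots_charpoly_smul_real (hA : A.IsHermitian) (c : ℝ) :
    (c • A).charpoly.roots = Multiset.map (fun i => (((c * hA.eigenvalues i : ℝ)) : 𝕜)) Finset.univ.val := by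
  have hne : (∏ i, (X - C (((c * hA.eigenvalues i : ℝ)) : 𝕜))) ≠ 0 :=
    Finset.prod_ne_zero_iff.mpr fun i _ => Polynomial.X_sub_C_ne_zero _
  rw [charpoly_smul_real hA c, Polynomial.roots_prod _ _ hne]
  simp_rw [Polynomial.roots_X_sub_C]
  rw [Multiset.bind_singleton]

/-- [cite: ImbrieJSP2016, eq. (5.3)] **Positive homogeneity of the ordered spectrum.** For a Hermitian matrix `A` and a
real `c ≥ 0`, Mathlib's (non-increasingly sorted) eigenvalue enumeration satisfies `eigenvalues (c • A) = c • eigenvalues A`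
as functions `n → ℝ`. (For `c < 0` the order reverses; not needed.) -/
theorem eigenvalues_smul_real (hA : A.IsHermitian) {c : ℝ} (hc : 0 ≤ c) :
    (isHermitian_smul_real hA c).eigenvalues = c • hA.eigenvalues := by
  set hcA := isHermitian_smul_real hA c
  set e : Fin (Fintype.card n) ≃ n := Fintype.equivOfCardEq (Fintype.card_fin _) with he
  have key : hcA.eigenvalues₀ = fun i => c * hA.eigenvalues₀ i := by
    apply List.ofFn_injective
    refine List.Perm.eq_of_sortedGE hcA.eigenvalues₀_antitone.sortedGE_ofFn
      ((hA.eigenvalues₀_antitone.const_mul hc).sortedGE_ofFn) ?_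
    rw [← Multiset.coe_eq_coe, ← Fin.univ_val_map, ← Fin.univ_val_map]
    have h1 : (c • A).charpoly.roots.map RCLike.re = Finset.univ.val.map hcA.eigenvalues₀ := by
      rw [hcA.roots_charpoly_eq_eigenvalues₀, Multiset.map_map]
      congr 1
      funext i
      simp
    have h2 : (c • A).charpoly.roots.map RCLike.re =
        Finset.univ.val.map (fun k : Fin (Fintype.card n) => c * hA.eigenvalues₀ k) := by
      rw [roots_charpoly_smul_real hA c, Multiset.map_map]
      have hfun : (RCLike.re ∘ fun i : n => (((c * hA.eigenvalues i : ℝ)) : 𝕜)) =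
          (fun k : Fin (Fintype.card n) => c * hA.eigenvalues₀ k) ∘ e.symm := by
        funext i
        simp only [Function.comp_apply, RCLike.ofReal_re]
        rfl
      rw [hfun, ← Multiset.map_map, Multiset.map_univ_val_equiv]
    rw [← h1, ← h2]
  funext i
  show hcA.eigenvalues₀ (e.symm i) = c • hA.eigenvalues₀ (e.symm i)
  rw [key, smul_eq_mul]

/-- [cite: ImbrieJSP2016, eq. (5.3)] Consequently every eigenvalue DIFFERENCE scales linearly:
`|λ_α(cA) - λ_β(cA)| = c |λ_α(A) - λ_β(A)|` for `c ≥ 0` — the degree-one homogeneity of `D_{αβ}` along rays that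
gives Euler's identity (5.3) `∂_r D_{αβ}(r) = D_{αβ}(r₀)/r₀`. -/
theorem abs_eigenvalues_sub_smul_real (hA : A.IsHermitian) {c : ℝ} (hc : 0 ≤ c) (α β : n) :
    |(isHermitian_smul_real hA c).eigenvalues α - (isHermitian_smul_real hA c).eigenvalues β| =
      c * |hA.eigenvalues α - hA.eigenvalues β| := by
  rw [eigenvalues_smul_real hA hc, Pi.smul_apply, Pi.smul_apply, smul_eq_mul, smul_eq_mul, ← mul_sub,
    abs_mul, abs_of_nonneg hc]

/-- [cite: ImbrieJSP2016, eq. (5.3) with eq. (1.1)] Transport to the Imbrie chain (LLA.lean, real symmetric `H γ p`): if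
the Hamiltonian at couplings `q` is `c •` the Hamiltonian at `p` (`c ≥ 0`; e.g. `q = ` the couplings of `p` scaled by
`c`, by linearity of (1.1) — `SmallGapDictionary.H_smul`), then the ordered spectra satisfy `eigs γ q = c • eigs γ p`. -/
theorem eigs_eq_smul_of_H_eq_smul {m : ℕ} (γ : ℝ) {c : ℝ} (hc : 0 ≤ c) (p q : Params m)
    (h : H γ q = c • H γ p) : eigs γ q = c • eigs γ p := by
  have key : ∀ (B : Matrix (Cfg m) (Cfg m) ℝ) (hB : B.IsHermitian), B = c • H γ p →
      hB.eigenvalues = c • (H_isHermitian γ p).eigenvalues := by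
    rintro B hB rfl
    exact eigenvalues_smul_real (H_isHermitian γ p) hc
  exact key _ (H_isHermitian γ q) h

/-- [cite: ImbrieJSP2016, eq. (5.3) with eq. (1.1)] Gap homogeneity: under the same hypothesis with `c > 0`, a pair of
levels of `H γ q` is `δ`-close iff the same pair of levels of `H γ p` is `δ / c`-close; in particular
`SmallGap γ δ q ↔ SmallGap γ (δ / c) p`. This is the scaling `D_{αβ}(r u) = (r / r₀) D_{αβ}(r₀ u)` behind (5.3). -/
theorem SmallGap_iff_of_H_eq_smul {m : ℕ} (γ δ : ℝ) {c : ℝ} (hc : 0 < c) (p q : Params m)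
    (h : H γ q = c • H γ p) : SmallGap γ δ q ↔ SmallGap γ (δ / c) p := by
  have hs := eigs_eq_smul_of_H_eq_smul γ hc.le p q h
  unfold SmallGap
  simp only [hs, Pi.smul_apply, smul_eq_mul, ← mul_sub, abs_mul, abs_of_pos hc]
  constructor
  · rintro ⟨α, β, hαβ, hlt⟩
    exact ⟨α, β, hαβ, by rw [lt_div_iff₀ hc]; linarith [mul_comm c (|eigs γ p α - eigs γ p β|)]⟩
  · rintro ⟨α, β, hαβ, hlt⟩
    exact ⟨α, β, hαβ, by rw [lt_div_iff₀ hc] at hlt; linarith [mul_comm c (|eigs γ p α - eigs γ p β|)]⟩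

end Literature.MathematicalPhysics.QuantumLattice.Imbrie2016.EigenvalueScaling

end
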